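import Summits.HodgeConjecture.CorCM.B01.Transposition.Item6OmegaChiSplitting
import Summits.HodgeConjecture.HodgeCM.CM.Basic
import Summits.HodgeConjecture.HodgeCM.Model.ArchSideTerm
import Literature.NumberTheory.Automorphic.Liu2021.Def411WeilCarriersLocalDataAtV
import Literature.NumberTheory.Automorphic.IdeleClassCharacterHecke
import Literature.RepresentationTheory.Liu2021.OscillatorConventions
import Literature.NumberTheory.GelbartRogawski1991.CMSplittingCharLocalMu
import Literature.RepresentationTheory.MoeglinVignerasWaldspurger1987.RankOneThetaLiftLinesDisjoint
import Literature.RepresentationTheory.MoeglinVignerasWaldspurger1987.RankOneThetaLiftTwistRigidity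
import Literature.RepresentationTheory.MoeglinVignerasWaldspurger1987.RankOneThetaLiftTwistRigiditySplit
import HarnessLib

/-!
# `hD3` line `a4-liuD3` — the ITEMS: the family of record `famAtV` at a finite place and the five thirds of
# [Liu2021, Lem. D.1 (3)] as CLOSED Props (v2 shape: `e := e₁`, rows IV-4c1 / IV-4c3 / IV-4c4 as leading binders)

Summits side, binder subdirectory `CorCM/HypD3/` (cell `hodgecm-mathlib`, fan A, rung A-IV; binder `HypD3` = [Liu2021, App. D Lem. D.1 (3)]
AS PRINTED per finite place; crux item stmt-HodgeConjecture-24837).  DEFINITIONS ONLY, nothing asserted: this file is §1 of the crux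
skeleton `A-plan/lines/a4-liuD3.lean` (v1 sha16 5422b04d6cb4d0fa, REF1 PASS 2026-08-28T02:57:41Z, namespace
`Summit.HodgeConjecture.CorCM.Lines.A4LiuD3`) in the v2 shape of the director's RULINGS 02:54:52Z (the five stub Props fix `e := e₁ =
Equiv.prodUnique (Fin 3) (Fin 1)`, the reindexing of the head `HypD3_of` — B-p13's `e′_a` line-model transport `LocalLineModelTransport.lean`
is the identity transport exactly there) and 02:58:23Z (D1) (the «⇒» Props take the IV-4c named facts they consume as EXPLICIT LEADING
binders: `SameClassChiOfIsoNonsplit` ← IV-4c1 `rankOne_theta_lines_disjoint`, `MuOfIsoNonsplit` ← IV-4c1 + IV-4c3 `rankOne_theta_twist_rigidity`,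
`SplitInjective` ← IV-4c4 `rankOne_theta_twist_rigidity_split`), LANDED so that the skeleton v2 and the four stub closers
(`CorCM/HypD3/A4LiuD3SameClassChiNonsplit` :185, `…SameClassOfSplit` :199, `…SplitInjectiveOfFacts` :195, B-p14 :190, B-p13 :203) resolve
the family `famAtV` and the five stub TYPES BY NAME (pattern of `CorCM/HypLiu418/A3Liu418EtaleItems.lean`; per-file copies of `famAtV` would
not be syntactically shared).  `famAtV` keeps its binder `e` byte-for-byte (v1 :94–:102), so `lemD1_3AsPrintedI_famAtV_of` and the general-`e`
closers are unaffected; the five Props are v1 :109–:182 with the binder `e` deleted and `famAtV F e₁ …` written.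

HC_CM is proved only modulo the 7 printed citations (`hDel`, `h21`, `hLiu418`, `h411`, `h413`, `hD3`, `hD1''`) until rung 0 closes; this file
proves nothing and discharges nothing.

## References
* [Liu2021] Y. Liu, Camb. J. Math. 9 (2021) = arXiv:2102.11518 — App. D §D.1 Steps 1∕2∕3 (l. 5213–5224), Lemma D.1 (3) (l. 5233), proof
  l. 5249–5266.
* [MoeglinVignerasWaldspurger1987] C. Mœglin, M.-F. Vignéras, J.-L. Waldspurger, LNM 1291, Chap. 3 IV.4.
* [GelbartRogawski1990] S. Gelbart, J. Rogawski, PS-Festschrift I (1990), Prop. 5.1.4.  [Kudla1994] Thm. 3.1.  [Minguez2008] Thm. 1.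
-/

set_option autoImplicit false

noncomputable section

namespace Summit.HodgeConjecture.CorCM.Lines.A4LiuD3
open scoped TensorProduct Matrix
open NumberField NumberField.InfinitePlace
open Literature.NumberTheory.ComplexMultiplication
open Literature.NumberTheory.Automorphic
open Literature.NumberTheory.Automorphic.IdeleClassGroup (toHeckeCharacter isUnitary_toHeckeCharacter)
open Literature.NumberTheory.Automorphic.Liu2021
open HodgeCM.Model.ArchSideTerm (e₁)
open Literature.NumberTheory.GelbartRogawski1991 Literature.NumberTheory.GelbartRogawski1991.UnitaryDualPair
open Literature.NumberTheory.GelbartRogawski1991.UnitaryDualPair.LocalSplitting (localMu norm_localMu continuous_localMu localMu_toLocalRing_eq_one_iff)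
open Literature.RepresentationTheory Literature.RepresentationTheory.Liu2021
open Literature.RepresentationTheory.MoeglinVignerasWaldspurger1987 (rankOne_theta_lines_disjoint rankOne_theta_twist_rigidity
  rankOne_theta_twist_rigidity_split)
open Summit.HodgeConjecture.CorCM.Transposition

/-! ## §1 The family of record at `v` (v1 :92–:102, byte-for-byte) -/

/-- **The family of record at `v`** (B-plan1) — `HypD3`'s instantiation of `Def411WeilCarriers.localIndexedFamilyAtV` made generic in the frame `dV` and the
index maps: member `t` = `(a_t, χ_t, χ-splitting of μ_t := toHeckeCharacter (ψ t), localMu μ_t)`. [cite: Liu2021, App. D §D.1 Steps 1∕2∕3 (l. 5213–5224)] -/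
def famAtV (F : HodgeCM.CMField) (e : Fin 3 × Fin 1 ≃ Fin 3) (dV : Fin 3 → (F : Type))
      (hdV : ∀ i, IsCMField.complexConj (F : Type) (dV i) = dV i) (hdV0 : ∀ i, dV i ≠ 0) {ι : Type}
      (ψ : ι → (Literature.NumberTheory.Automorphic.IdeleClassGroup (F : Type) →ₜ* Circle))
      (hψ : ∀ t, IdeleClassGroup.IsConjugateSymplectic (F : Type) (ψ t))
      (aOf : ι → (↥(maximalRealSubfield (F : Type)))ˣ)
      (χOf : ι → Def411WeilCarriers.Chi ↥(maximalRealSubfield (F : Type)) (F : Type) (IsCMField.complexConj (F : Type)))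
      (v : IsDedekindDomain.HeightOneSpectrum (𝓞 ↥(maximalRealSubfield (F : Type)))) :
    LemD1IndexedFamily (v.adicCompletion ↥(maximalRealSubfield (F : Type))) (UnitaryGroup.LocalRing (F : Type) v) 3 ι :=
  Def411WeilCarriers.localIndexedFamilyAtV (ι := ι) ↥(maximalRealSubfield (F : Type)) (F : Type) (IsCMField.complexConj (F : Type)) 3 e (Matrix.diagonal dV) (complexConj_imagUnit (F : Type)) (imagUnit_ne_zero (F : Type)) (imagUnit_mul_self (F : Type)) (realDiagonal_isSymm (F : Type) dV hdV) (isUnit_det_realDiagonal (F : Type) dV hdV hdV0) (realDiagonal_map (F : Type) dV hdV).symm (le_refl 3) aOf χOf (fun t => OmegaChiSplitting.chiLocalSplittingsD ⟨HodgeCM.CMField.K F⟩ e dV hdV hdV0 (toHeckeCharacter (F : Type) (ψ t)) ((isOscillatorChar_toHeckeCharacter_iff (ψ t)).mpr (hψ t)) (aOf t)) (fun t => localMu (F : Type) (toHeckeCharacter (F : Type) (ψ t))) (fun t v x => norm_localMu (F : Type) (toHeckeCharacter (F : Type) (ψ t)) v (isUnitary_toHeckeCharacter (F : Type) (ψ t))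 x) (fun t => continuous_localMu (F : Type) (toHeckeCharacter (F : Type) (ψ t))) (fun t v x => localMu_toLocalRing_eq_one_iff (F : Type) (toHeckeCharacter (F : Type) (ψ t)) v ((isOscillatorChar_toHeckeCharacter_iff (ψ t)).mpr (hψ t)) x) v

/-! ## §2 The five thirds of [Lem. D.1 (3)] as CLOSED Props (v2 shape) -/

/-- STUB TYPE («⇒ ε-class and χ» at NON-SPLIT `v`, B-plan1's first stub restricted by `IsField (F ⊗ F⁺_v)`; v2: `e := e₁`, row IV-4c1 as LEADING binder): isomorphic members have ε-representatives
in one `Nm(E_vˣ)`-class and equal centre characters.  Rows IV-4c1 (`rankOne_theta_lines_disjoint`, contrapositive; carries `hE`) + IV-4c2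
(`rankOne_thetaChar_eq_of_areIsomorphicRep`), packaged by B-p13's `rankOne_theta_sameClass_and_char_eq_of_areIsomorphicRep` (p596487, `(hE : IsField …)`),
moved to family currency by the model transport `e′_a`. [cite: Liu2021, App. D Lem. D.1 (3) (l. 5233), proof l. 5255] [cite: MoeglinVignerasWaldspurger1987, Ch. 3 IV.4]
[cite: GelbartRogawski1990, Prop. 5.1.4] -/
def SameClassChiOfIsoNonsplit : Prop :=
  rankOne_theta_lines_disjoint →
  ∀ (F : HodgeCM.CMField) (dV : Fin 3 → (F : Type))
      (hdV : ∀ i, IsCMField.complexConj (F : Type) (dV i) = dV i) (hdV0 : ∀ i, dV i ≠ 0) {ι : Type}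
      (ψ : ι → (Literature.NumberTheory.Automorphic.IdeleClassGroup (F : Type) →ₜ* Circle))
      (hψ : ∀ t, IdeleClassGroup.IsConjugateSymplectic (F : Type) (ψ t))
      (aOf : ι → (↥(maximalRealSubfield (F : Type)))ˣ)
      (χOf : ι → Def411WeilCarriers.Chi ↥(maximalRealSubfield (F : Type)) (F : Type) (IsCMField.complexConj (F : Type)))
      (v : IsDedekindDomain.HeightOneSpectrum (𝓞 ↥(maximalRealSubfield (F : Type)))),
      IsField (UnitaryGroup.LocalRing (F : Type) v) →
      ∀ i j : ι, AreIsomorphicRep ((famAtV F e₁ dV hdV hdV0 ψ hψ aOf χOf v).quot j) ((famAtV F e₁ dV hdV hdV0 ψ hψ aOf χOf v).quot i) →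
        LemD1.SameClass ((famAtV F e₁ dV hdV hdV0 ψ hψ aOf χOf v).eps i) ((famAtV F e₁ dV hdV hdV0 ψ hψ aOf χOf v).eps j) ∧ (famAtV F e₁ dV hdV hdV0 ψ hψ aOf χOf v).chi j = (famAtV F e₁ dV hdV hdV0 ψ hψ aOf χOf v).chi i

/-- STUB TYPE («⇒ μ» at NON-SPLIT `v`, B-plan1's second stub restricted by `IsField`; v2: `e := e₁`, rows IV-4c1, IV-4c3 as LEADING binders): isomorphic members have equal Step-2 characters `μ_{j,v} = μ_{i,v}`
— after the ε-classes agree, transport member `j` to member `i`'s model; row IV-4c3 `rankOne_theta_twist_rigidity` gives equal sections; the χ-splitting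
determines `μ` locally (Kudla splitting; `chiLocalSplittingsD`). [cite: Liu2021, App. D Lem. D.1 (3) (l. 5233)] [cite: Kudla1994, Thm. 3.1]
[cite: MoeglinVignerasWaldspurger1987, Ch. 3 IV.4] -/
def MuOfIsoNonsplit : Prop :=
  rankOne_theta_lines_disjoint → rankOne_theta_twist_rigidity →
  ∀ (F : HodgeCM.CMField) (dV : Fin 3 → (F : Type))
      (hdV : ∀ i, IsCMField.complexConj (F : Type) (dV i) = dV i) (hdV0 : ∀ i, dV i ≠ 0) {ι : Type}
      (ψ : ι → (Literature.NumberTheory.Automorphic.IdeleClassGroup (F : Type) →ₜ* Circle))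
      (hψ : ∀ t, IdeleClassGroup.IsConjugateSymplectic (F : Type) (ψ t))
      (aOf : ι → (↥(maximalRealSubfield (F : Type)))ˣ)
      (χOf : ι → Def411WeilCarriers.Chi ↥(maximalRealSubfield (F : Type)) (F : Type) (IsCMField.complexConj (F : Type)))
      (v : IsDedekindDomain.HeightOneSpectrum (𝓞 ↥(maximalRealSubfield (F : Type)))),
      IsField (UnitaryGroup.LocalRing (F : Type) v) →
      ∀ i j : ι, AreIsomorphicRep ((famAtV F e₁ dV hdV hdV0 ψ hψ aOf χOf v).quot j) ((famAtV F e₁ dV hdV hdV0 ψ hψ aOf χOf v).quot i) → (famAtV F e₁ dV hdV hdV0 ψ hψ aOf χOf v).mu j = (famAtV F e₁ dV hdV hdV0 ψ hψ aOf χOf v).mu i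

/-- STUB TYPE («⇒ μ and χ» at SPLIT `v`, row IV-4c4 — director RULING q4 02:20:53Z; v2: `e := e₁`, row IV-4c4 as LEADING binder): at a place `v` of `F⁺` split in `F` (`¬ IsField (F ⊗ F⁺_v)`,
`U(V)(F⁺_v) ≅ GL₃(F⁺_v)`, the centre `≅ GL₁`), isomorphic members have equal `μ_v` and equal `χ_v`: the theta lift of a character `χ` of `GL₁` to `GL₃`
is the Langlands quotient of `ν^{-1/2}χ̃ × ν^{1/2} × …` determined by `(μ, χ)` (type II Howe duality [Mínguez 2008, Thm 1 = Cor. 6.3 p. 719]) and Langlands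
data are unique [BZ77 Thm 2.9]; closes BY NAME from the named fact IV-4c4 (to be typed in δ-model currency, then the model transport).
WHY IT MIGHT FAIL: only through the normalisation of the splitting at split `v` (the `μ`-twist must be read on the correct `GL₁ × GL₃` factor).
[cite: Minguez2008, Thm. 1, Cor. 6.3] [cite: BernsteinZelevinsky1977, Thm. 2.9] [cite: Liu2021, App. D Lem. D.1 (3), proof l. 5253] -/
def SplitInjective : Prop :=
  rankOne_theta_twist_rigidity_split →
  ∀ (F : HodgeCM.CMField) (dV : Fin 3 → (F : Type))
      (hdV : ∀ i, IsCMField.complexConj (F : Type) (dV i) = dV i) (hdV0 : ∀ i, dV i ≠ 0) {ι : Type}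
      (ψ : ι → (Literature.NumberTheory.Automorphic.IdeleClassGroup (F : Type) →ₜ* Circle))
      (hψ : ∀ t, IdeleClassGroup.IsConjugateSymplectic (F : Type) (ψ t))
      (aOf : ι → (↥(maximalRealSubfield (F : Type)))ˣ)
      (χOf : ι → Def411WeilCarriers.Chi ↥(maximalRealSubfield (F : Type)) (F : Type) (IsCMField.complexConj (F : Type)))
      (v : IsDedekindDomain.HeightOneSpectrum (𝓞 ↥(maximalRealSubfield (F : Type)))),
      ¬ IsField (UnitaryGroup.LocalRing (F : Type) v) →
      ∀ i j : ι, AreIsomorphicRep ((famAtV F e₁ dV hdV hdV0 ψ hψ aOf χOf v).quot j) ((famAtV F e₁ dV hdV hdV0 ψ hψ aOf χOf v).quot i) → (famAtV F e₁ dV hdV hdV0 ψ hψ aOf χOf v).mu j = (famAtV F e₁ dV hdV hdV0 ψ hψ aOf χOf v).mu i ∧ (famAtV F e₁ dV hdV hdV0 ψ hψ aOf χOf v).chi j = (famAtV F e₁ dV hdV hdV0 ψ hψ aOf χOf v).chi i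

/-- STUB TYPE (the ε-clause at SPLIT `v`, PROVABLE, fan A, M; v2: `e := e₁`): at a split place ALL members' ε-representatives lie in one `Nm`-class — `F ⊗ F⁺_v ≅
F⁺_v × F⁺_v` with `c ⊗ 1` the swap, so every `u ∈ F⁺_vˣ` (diagonal) is `x · c(x)` with `x = (u, 1)`, and `ε_j ε_i⁻¹ = a_j a_i⁻¹ ∈ F⁺_vˣ`
(`eps t = epsLine F hδ (aOf t) v`).  WHY IT MIGHT FAIL: it cannot mathematically; the Lean cost is the split-place structure of `UnitaryGroup.LocalRing`
(`PlacesOver F v` has two elements swapped by `c`) — cf. fan B's split-place model row IV-3. [cite: Liu2021, App. D Lem. D.1 (3), proof l. 5253]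
[cite: CasselsFrohlichANT1967, Ch. II §10–§11] -/
def SameClassOfSplit : Prop :=
  ∀ (F : HodgeCM.CMField) (dV : Fin 3 → (F : Type))
      (hdV : ∀ i, IsCMField.complexConj (F : Type) (dV i) = dV i) (hdV0 : ∀ i, dV i ≠ 0) {ι : Type}
      (ψ : ι → (Literature.NumberTheory.Automorphic.IdeleClassGroup (F : Type) →ₜ* Circle))
      (hψ : ∀ t, IdeleClassGroup.IsConjugateSymplectic (F : Type) (ψ t))
      (aOf : ι → (↥(maximalRealSubfield (F : Type)))ˣ)
      (χOf : ι → Def411WeilCarriers.Chi ↥(maximalRealSubfield (F : Type)) (F : Type) (IsCMField.complexConj (F : Type)))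
      (v : IsDedekindDomain.HeightOneSpectrum (𝓞 ↥(maximalRealSubfield (F : Type)))),
      ¬ IsField (UnitaryGroup.LocalRing (F : Type) v) →
      ∀ i j : ι, LemD1.SameClass ((famAtV F e₁ dV hdV hdV0 ψ hψ aOf χOf v).eps i) ((famAtV F e₁ dV hdV hdV0 ψ hψ aOf χOf v).eps j)

/-- STUB TYPE («⇐», B-plan1's third stub, all `v`; v2: `e := e₁`): equal `(μ_v, ε-class, χ_v)` ⇒ isomorphic members — isometry transport along `ε′ = x x̄ ε` (row IV-4(b)
`weilRep_iso_of_isometry` shape; tree `LemD1DataOfPlaceIsometric` ∕ `IndexedCarrierTransport`) and equality of the χ-splitting sections for equal local `μ`.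
WHY IT MIGHT FAIL: only if two χ-splittings with the same local `μ_v` could differ at `v` — they do not (`chiLocalSplittingsD … .s v` is determined by `μ_v`
and `a_t`, and the `a`-dependence is absorbed by the transport). [cite: Liu2021, App. D Lem. D.1 (3) (l. 5233)] [cite: Kudla1994, Thm. 3.1] -/
def IsoOfParams : Prop :=
  ∀ (F : HodgeCM.CMField) (dV : Fin 3 → (F : Type))
      (hdV : ∀ i, IsCMField.complexConj (F : Type) (dV i) = dV i) (hdV0 : ∀ i, dV i ≠ 0) {ι : Type}
      (ψ : ι → (Literature.NumberTheory.Automorphic.IdeleClassGroup (F : Type) →ₜ* Circle))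
      (hψ : ∀ t, IdeleClassGroup.IsConjugateSymplectic (F : Type) (ψ t))
      (aOf : ι → (↥(maximalRealSubfield (F : Type)))ˣ)
      (χOf : ι → Def411WeilCarriers.Chi ↥(maximalRealSubfield (F : Type)) (F : Type) (IsCMField.complexConj (F : Type)))
      (v : IsDedekindDomain.HeightOneSpectrum (𝓞 ↥(maximalRealSubfield (F : Type)))),
      ∀ i j : ι, (famAtV F e₁ dV hdV hdV0 ψ hψ aOf χOf v).mu j = (famAtV F e₁ dV hdV hdV0 ψ hψ aOf χOf v).mu i → LemD1.SameClass ((famAtV F e₁ dV hdV hdV0 ψ hψ aOf χOf v).eps i) ((famAtV F e₁ dV hdV hdV0 ψ hψ aOf χOf v).eps j) → (famAtV F e₁ dV hdV hdV0 ψ hψ aOf χOf v).chi j = (famAtV F e₁ dV hdV hdV0 ψ hψ aOf χOf v).chi i →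
        AreIsomorphicRep ((famAtV F e₁ dV hdV hdV0 ψ hψ aOf χOf v).quot j) ((famAtV F e₁ dV hdV hdV0 ψ hψ aOf χOf v).quot i)

end Summit.HodgeConjecture.CorCM.Lines.A4LiuD3

end
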